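import Summits.KontsevichZagierPeriods.KontsevichZagierPeriods.Theorems.FurushoPentagonPentagonInKZCornerSeries
import Literature.NumberTheory.Transcendental.AssociatorsBaseChange

/-!
# `PentagonInKZ`: stub `stub_cornerPrinciple` — the log-free corner principle

The registered stub `stub_cornerPrinciple` of the crux `FurushoPentagon.PentagonInKZ`
(stmt-KontsevichZagierPeriods-11348; lines `edge-normal-newton-leibniz` / `logfree-gauge-corner-flatness`):
for a bilinear corner chart of the KZ atlas, flat and axis-central over `ℝ`, and any realisation
`χ` of the Kontsevich–Zagier rules, the end-regularised transports of the four sides of the box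
satisfy `V_α(β) · H_0(α) = H_β(α) · V_0(β)` at the truncated residues.  This file transfers the
real hypotheses to the target algebra (T1–T2: injective base change `ℚ → ℝ` of the truncated
Drinfeld–Kohno algebra; T3: extension to the closed box by the polynomial identity principle
`polyIdentity_of_eval`; T4: base change `ℚ → R`) and applies `corner_principle`
(`cornerPrinciple_chart`). [cite: Furusho2010, §3]
-/

noncomputable section

open MeasureTheory Set MvPolynomial

namespace Summit.KontsevichZagierPeriods.FurushoPentagon.PentagonInKZ

open Literature.NumberTheory.Transcendental Literature.NumberTheory.Transcendental.KZ Literature.NumberTheory.Transcendental.KZ.Cube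

namespace CornerTransfer

open DrinfeldKohnoTrunc

variable {m N : ℕ} (cf : Fin (m + 2) → Fin 4 → ℚ) (nZ : Fin (m + 2) → Fin 4 → Fin 4 → ℤ)

/-- The residues over `ℚ`. [folklore] -/
def Zq (k : Fin (m + 2)) : DrinfeldKohnoTrunc ℚ (Fin 4) N := ∑ i : Fin 4, ∑ j : Fin 4, (nZ k i j : ℚ) • DrinfeldKohnoTrunc.t ℚ N i j

/-- Base change of the rational residues. [folklore] -/
theorem map_Zq {S : Type} [CommRing S] [Algebra ℚ S] (k : Fin (m + 2)) :
    DrinfeldKohnoTrunc.map (algebraMap ℚ S) (Zq (N := N) nZ k) = ∑ i : Fin 4, ∑ j : Fin 4, (nZ k i j : S) • DrinfeldKohnoTrunc.t S N i j := by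
  simp [Zq, map_sum, DrinfeldKohnoTrunc.map_smul]

/-- The scalar of the divisor `ℓ` in the `x`-connection: `x(B + Dy)/φ`. [folklore] -/
def sX (ℓ : Fin m) (x y : ℚ) : ℚ :=
  (cf (ℓ.addNat 2) 1 + cf (ℓ.addNat 2) 3 * y) * x / (cf (ℓ.addNat 2) 0 + cf (ℓ.addNat 2) 1 * x + cf (ℓ.addNat 2) 2 * y + cf (ℓ.addNat 2) 3 * x * y)

/-- The scalar of the divisor `ℓ` in the `y`-connection: `y(C + Dx)/φ`. [folklore] -/
def sY (ℓ : Fin m) (x y : ℚ) : ℚ :=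
  (cf (ℓ.addNat 2) 2 + cf (ℓ.addNat 2) 3 * x) * y / (cf (ℓ.addNat 2) 0 + cf (ℓ.addNat 2) 1 * x + cf (ℓ.addNat 2) 2 * y + cf (ℓ.addNat 2) 3 * x * y)

/-- The contracted `x`-connection over `ℚ`. [folklore] -/
def OmX (x y : ℚ) : DrinfeldKohnoTrunc ℚ (Fin 4) N := Zq nZ 0 + ∑ ℓ : Fin m, sX cf ℓ x y • Zq nZ (ℓ.addNat 2)

/-- The contracted `y`-connection over `ℚ`. [folklore] -/
def OmY (x y : ℚ) : DrinfeldKohnoTrunc ℚ (Fin 4) N := Zq nZ 1 + ∑ ℓ : Fin m, sY cf ℓ x y • Zq nZ (ℓ.addNat 2)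

variable (hcf0 : cf 0 = ![0, 1, 0, 0]) (hcf1 : cf 1 = ![0, 0, 1, 0])
variable (φ f g : Fin (m + 2) → ℝ → ℝ → ℝ)
variable (hφ : ∀ k x y, φ k x y = cf k 0 + cf k 1 * x + cf k 2 * y + cf k 3 * x * y)
variable (hf : ∀ k x y, f k x y = (cf k 1 + cf k 3 * y) / φ k x y) (hg : ∀ k x y, g k x y = (cf k 2 + cf k 3 * x) / φ k x y)
variable (Zr : Fin (m + 2) → DrinfeldKohnoTrunc ℝ (Fin 4) N)
variable (hZr : ∀ k, Zr k = ∑ i : Fin 4, ∑ j : Fin 4, (nZ k i j : ℝ) • DrinfeldKohnoTrunc.t ℝ N i j)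

include hZr in
/-- The real residues are the base change of the rational ones. [folklore] -/
theorem map_Zq_real (k : Fin (m + 2)) : DrinfeldKohnoTrunc.map (algebraMap ℚ ℝ) (Zq (N := N) nZ k) = Zr k := by
  rw [map_Zq, hZr]

include hcf0 hcf1 hφ hf hg in
/-- Values of the chart functions on the axes letters. [folklore] -/
theorem axis_values (x y : ℝ) : φ 0 x y = x ∧ φ 1 x y = y ∧ f 0 x y = 1 / x ∧ f 1 x y = 0 ∧ g 0 x y = 0 ∧ g 1 x y = 1 / y := by
  have c00 : cf 0 0 = 0 := by rw [hcf0]; rfl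
  have c01 : cf 0 1 = 1 := by rw [hcf0]; rfl
  have c02 : cf 0 2 = 0 := by rw [hcf0]; rfl
  have c03 : cf 0 3 = 0 := by rw [hcf0]; rfl
  have c10 : cf 1 0 = 0 := by rw [hcf1]; rfl
  have c11 : cf 1 1 = 0 := by rw [hcf1]; rfl
  have c12 : cf 1 2 = 1 := by rw [hcf1]; rfl
  have c13 : cf 1 3 = 0 := by rw [hcf1]; rfl
  have h0 : φ 0 x y = x := by rw [hφ, c00, c01, c02, c03]; push_cast; ring
  have h1 : φ 1 x y = y := by rw [hφ, c10, c11, c12, c13]; push_cast; ring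
  refine ⟨h0, h1, ?_, ?_, ?_, ?_⟩
  · rw [hf, h0, c01, c03]; push_cast; ring
  · rw [hf, c11, c13]; push_cast; ring
  · rw [hg, c02, c03]; push_cast; ring
  · rw [hg, h1, c12, c13]; push_cast; ring

include hcf0 hcf1 hφ hf hg hZr in
/-- **(T1–T2) Flatness at the rational points of the open box, over `ℚ`.** [cite: Furusho2010, §3] -/
theorem commute_Om_open {α β : ℚ}
    (F1 : ∀ x y : ℝ, 0 < x → x < (α : ℝ) → 0 < y → y < (β : ℝ) →
      ∑ k : Fin (m + 2), ∑ l : Fin (m + 2), (f k x y * g l x y) • (Zr k * Zr l - Zr l * Zr k) = 0)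
    (x y : ℚ) (hx : 0 < x) (hxα : x < α) (hy : 0 < y) (hyβ : y < β) :
    Commute (OmX (N := N) cf nZ x y) (OmY cf nZ x y) := by
  have hxr : (0 : ℝ) < x := by exact_mod_cast hx
  have hyr : (0 : ℝ) < y := by exact_mod_cast hy
  obtain ⟨_, _, f0, f1, g0, g1⟩ := axis_values cf hcf0 hcf1 φ f g hφ hf hg (x : ℝ) (y : ℝ)
  have hreal := commute_of_double_sum (K := ℝ) (fun k => f k x y) (fun k => g k x y) Zr (x : ℝ) (y : ℝ)
    (F1 x y hxr (by exact_mod_cast hxα) hyr (by exact_mod_cast hyβ)) (by rw [f0, mul_one_div_cancel hxr.ne']) f1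
    (by rw [g1, mul_one_div_cancel hyr.ne']) g0
  -- transfer to `ℚ` through the injective base change
  have hinj := DrinfeldKohnoTrunc.map_injective (ι := Fin 4) (N := N) (f := algebraMap ℚ ℝ) (algebraMap ℚ ℝ).injective
  have hmapX : DrinfeldKohnoTrunc.map (algebraMap ℚ ℝ) (OmX (N := N) cf nZ x y) =
      Zr 0 + ∑ ℓ : Fin m, ((x : ℝ) * f (ℓ.addNat 2) x y) • Zr (ℓ.addNat 2) := by
    rw [OmX, map_add, map_sum, map_Zq_real nZ Zr hZr]
    congr 1
    refine Finset.sum_congr rfl fun ℓ _ => ?_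
    rw [DrinfeldKohnoTrunc.map_smul, map_Zq_real nZ Zr hZr, hf, hφ, sX, eq_ratCast]
    congr 1
    push_cast
    ring
  have hmapY : DrinfeldKohnoTrunc.map (algebraMap ℚ ℝ) (OmY (N := N) cf nZ x y) =
      Zr 1 + ∑ ℓ : Fin m, ((y : ℝ) * g (ℓ.addNat 2) x y) • Zr (ℓ.addNat 2) := by
    rw [OmY, map_add, map_sum, map_Zq_real nZ Zr hZr]
    congr 1
    refine Finset.sum_congr rfl fun ℓ _ => ?_
    rw [DrinfeldKohnoTrunc.map_smul, map_Zq_real nZ Zr hZr, hg, hφ, sY, eq_ratCast]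
    congr 1
    push_cast
    ring
  apply hinj
  rw [map_mul, map_mul, hmapX, hmapY]
  exact hreal

/-! ### (T3) Extension to the closed box by the polynomial identity principle -/

/-- The divisor polynomials `Φ_ℓ ∈ ℚ[x,y]`. [folklore] -/
def Φ (ℓ : Fin m) : MvPolynomial (Fin 2) ℚ :=
  MvPolynomial.C (cf (ℓ.addNat 2) 0) + MvPolynomial.C (cf (ℓ.addNat 2) 1) * MvPolynomial.X 0 + MvPolynomial.C (cf (ℓ.addNat 2) 2) * MvPolynomial.X 1 +
    MvPolynomial.C (cf (ℓ.addNat 2) 3) * MvPolynomial.X 0 * MvPolynomial.X 1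

/-- The product of all divisor polynomials. [folklore] -/
def PiD : MvPolynomial (Fin 2) ℚ := ∏ ℓ : Fin m, Φ cf ℓ

/-- The cleared `x`-connection coefficients. [folklore] -/
def PX : Option (Fin m) → MvPolynomial (Fin 2) ℚ := fun a => a.elim (PiD cf) fun ℓ =>
  (MvPolynomial.C (cf (ℓ.addNat 2) 1) + MvPolynomial.C (cf (ℓ.addNat 2) 3) * MvPolynomial.X 1) * MvPolynomial.X 0 * ∏ ℓ' ∈ Finset.univ.erase ℓ, Φ cf ℓ'

/-- The cleared `y`-connection coefficients. [folklore] -/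
def PY : Option (Fin m) → MvPolynomial (Fin 2) ℚ := fun a => a.elim (PiD cf) fun ℓ =>
  (MvPolynomial.C (cf (ℓ.addNat 2) 2) + MvPolynomial.C (cf (ℓ.addNat 2) 3) * MvPolynomial.X 0) * MvPolynomial.X 1 * ∏ ℓ' ∈ Finset.univ.erase ℓ, Φ cf ℓ'

/-- The residues of the `x`-connection indexed by `Option (Fin m)`. [folklore] -/
def ZX : Option (Fin m) → DrinfeldKohnoTrunc ℚ (Fin 4) N := fun a => a.elim (Zq nZ 0) fun ℓ => Zq nZ (ℓ.addNat 2)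

/-- The residues of the `y`-connection indexed by `Option (Fin m)`. [folklore] -/
def ZY : Option (Fin m) → DrinfeldKohnoTrunc ℚ (Fin 4) N := fun a => a.elim (Zq nZ 1) fun ℓ => Zq nZ (ℓ.addNat 2)

/-- The rational divisor value. [folklore] -/
def φq (ℓ : Fin m) (x y : ℚ) : ℚ := cf (ℓ.addNat 2) 0 + cf (ℓ.addNat 2) 1 * x + cf (ℓ.addNat 2) 2 * y + cf (ℓ.addNat 2) 3 * x * y

/-- Evaluating `Φ_ℓ`. [folklore] -/
theorem aeval_Φ (ℓ : Fin m) (x y : ℚ) : MvPolynomial.aeval ![x, y] (Φ cf ℓ) = φq cf ℓ x y := by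
  simp only [Φ, φq, map_add, map_mul, MvPolynomial.aeval_C, MvPolynomial.aeval_X, eq_ratCast, Rat.cast_id, Matrix.cons_val_zero,
    Matrix.cons_val_one]

/-- **The cleared connections are `PiD` times the connections** where the divisors do not vanish. [folklore] -/
theorem sum_PX_eq (x y : ℚ) (hφ0 : ∀ ℓ, φq cf ℓ x y ≠ 0) :
    ∑ a, MvPolynomial.aeval ![x, y] (PX cf a) • ZX (N := N) nZ a = MvPolynomial.aeval ![x, y] (PiD cf) • OmX cf nZ x y ∧
    ∑ a, MvPolynomial.aeval ![x, y] (PY cf a) • ZY (N := N) nZ a = MvPolynomial.aeval ![x, y] (PiD cf) • OmY cf nZ x y := by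
  have hPi : MvPolynomial.aeval ![x, y] (PiD cf) = ∏ ℓ, φq cf ℓ x y := by rw [PiD, map_prod]; simp only [aeval_Φ]
  have herase : ∀ ℓ, MvPolynomial.aeval ![x, y] (∏ ℓ' ∈ Finset.univ.erase ℓ, Φ cf ℓ') * φq cf ℓ x y = ∏ ℓ', φq cf ℓ' x y := by
    intro ℓ
    rw [map_prod]
    simp only [aeval_Φ]
    exact Finset.prod_erase_mul _ _ (Finset.mem_univ ℓ)
  constructor
  · rw [Fintype.sum_option, OmX, smul_add, Finset.smul_sum]
    simp only [PX, ZX, Option.elim]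
    congr 1
    refine Finset.sum_congr rfl fun ℓ _ => ?_
    rw [smul_smul]
    congr 1
    rw [map_mul, map_mul, hPi, sX, ← herase ℓ]
    have := hφ0 ℓ
    simp only [φq] at this ⊢
    simp only [map_add, map_mul, MvPolynomial.aeval_C, MvPolynomial.aeval_X, eq_ratCast, Rat.cast_id, Matrix.cons_val_zero, Matrix.cons_val_one]
    rw [mul_div_assoc', eq_div_iff this]
    ring
  · rw [Fintype.sum_option, OmY, smul_add, Finset.smul_sum]
    simp only [PY, ZY, Option.elim]
    congr 1
    refine Finset.sum_congr rfl fun ℓ _ => ?_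
    rw [smul_smul]
    congr 1
    rw [map_mul, map_mul, hPi, sY, ← herase ℓ]
    have := hφ0 ℓ
    simp only [φq] at this ⊢
    simp only [map_add, map_mul, MvPolynomial.aeval_C, MvPolynomial.aeval_X, eq_ratCast, Rat.cast_id, Matrix.cons_val_zero, Matrix.cons_val_one]
    rw [mul_div_assoc', eq_div_iff this]
    ring

include hcf0 hcf1 hφ hf hg hZr in
/-- **(T3) Flatness at the rational points of the CLOSED box, over `ℚ`.** [cite: Furusho2010, §3] -/
theorem commute_Om_closed {α β : ℚ} (hα : 0 < α) (hβ : 0 < β)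
    (hreg : ∀ (ℓ : Fin m) (x y : ℚ), 0 ≤ x → x ≤ α → 0 ≤ y → y ≤ β → φq cf ℓ x y ≠ 0)
    (F1 : ∀ x y : ℝ, 0 < x → x < (α : ℝ) → 0 < y → y < (β : ℝ) →
      ∑ k : Fin (m + 2), ∑ l : Fin (m + 2), (f k x y * g l x y) • (Zr k * Zr l - Zr l * Zr k) = 0)
    (x y : ℚ) (hx : 0 ≤ x) (hxα : x ≤ α) (hy : 0 ≤ y) (hyβ : y ≤ β) :
    Commute (OmX (N := N) cf nZ x y) (OmY cf nZ x y) := by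
  -- the polynomial family
  let P : Option (Fin m) × Option (Fin m) → MvPolynomial (Fin 2) ℚ := fun ab => PX cf ab.1 * PY cf ab.2
  let v : Option (Fin m) × Option (Fin m) → DrinfeldKohnoTrunc ℚ (Fin 4) N := fun ab => ZX nZ ab.1 * ZY nZ ab.2 - ZY nZ ab.2 * ZX nZ ab.1
  -- the cleared commutator
  have hclear : ∀ x y : ℚ, ∑ ab, MvPolynomial.aeval ![x, y] (P ab) • v ab =
      (∑ a, MvPolynomial.aeval ![x, y] (PX cf a) • ZX (N := N) nZ a) * (∑ b, MvPolynomial.aeval ![x, y] (PY cf b) • ZY (N := N) nZ b) -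
        (∑ b, MvPolynomial.aeval ![x, y] (PY cf b) • ZY (N := N) nZ b) * (∑ a, MvPolynomial.aeval ![x, y] (PX cf a) • ZX (N := N) nZ a) := by
    intro x y
    rw [comm_sum_smul, Fintype.sum_prod_type]
    simp only [P, v, map_mul]
  -- vanishing on the open box
  have hopen : ∀ x y : ℚ, 0 < x → x < α → 0 < y → y < β → ∑ ab, MvPolynomial.aeval ![x, y] (P ab) • v ab = 0 := by
    intro x y hx hxα hy hyβ
    have hφ0 : ∀ ℓ, φq cf ℓ x y ≠ 0 := fun ℓ => hreg ℓ x y hx.le hxα.le hy.le hyβ.le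
    obtain ⟨eX, eY⟩ := sum_PX_eq cf nZ (N := N) x y hφ0
    rw [hclear, eX, eY, smul_mul_smul_comm, smul_mul_smul_comm, (commute_Om_open cf nZ hcf0 hcf1 φ f g hφ hf hg Zr hZr F1 x y hx hxα hy hyβ).eq, sub_self]
  -- hence all coefficients vanish, hence the values on the closed box
  have hcoeff := polyIdentity_of_eval (DrinfeldKohnoTrunc ℚ (Fin 4) N) (Option (Fin m) × Option (Fin m)) P v 0 α 0 β hα hβ hopen
  have hval := sum_aeval_smul_eq_zero P v hcoeff x y
  have hφ0 : ∀ ℓ, φq cf ℓ x y ≠ 0 := fun ℓ => hreg ℓ x y hx hxα hy hyβ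
  obtain ⟨eX, eY⟩ := sum_PX_eq cf nZ (N := N) x y hφ0
  rw [hclear, eX, eY, smul_mul_smul_comm, smul_mul_smul_comm, ← smul_sub, smul_eq_zero] at hval
  rcases hval with h0 | hval
  · exfalso
    rw [mul_self_eq_zero] at h0
    have : MvPolynomial.aeval ![x, y] (PiD cf) ≠ 0 := by
      rw [show MvPolynomial.aeval ![x, y] (PiD cf) = ∏ ℓ, φq cf ℓ x y by rw [PiD, map_prod]; simp only [aeval_Φ]]
      exact Finset.prod_ne_zero_iff.mpr fun ℓ _ => hφ0 ℓ
    exact this h0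
  · rw [Commute, SemiconjBy, ← sub_eq_zero]; exact hval

/-! ### (T4) To the target algebra -/

variable {R : Type} [CommRing R] [Algebra ℚ R] (Z : Fin (m + 2) → DrinfeldKohnoTrunc R (Fin 4) N)
variable (hZ : ∀ k, Z k = ∑ i : Fin 4, ∑ j : Fin 4, (nZ k i j : R) • DrinfeldKohnoTrunc.t R N i j)

include hZ in
/-- The target residues are the base change of the rational ones. [folklore] -/
theorem map_Zq_R (k : Fin (m + 2)) : DrinfeldKohnoTrunc.map (algebraMap ℚ R) (Zq (N := N) nZ k) = Z k := by
  rw [map_Zq, hZ]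

include hcf0 hcf1 hφ hf hg hZr hZ in
/-- **Flatness in the target algebra (my form `F1Q`).** [cite: Furusho2010, §3] -/
theorem F1Q {α β : ℚ} (hα : 0 < α) (hβ : 0 < β)
    (hreg : ∀ (ℓ : Fin m) (x y : ℚ), 0 ≤ x → x ≤ α → 0 ≤ y → y ≤ β → φq cf ℓ x y ≠ 0)
    (F1 : ∀ x y : ℝ, 0 < x → x < (α : ℝ) → 0 < y → y < (β : ℝ) →
      ∑ k : Fin (m + 2), ∑ l : Fin (m + 2), (f k x y * g l x y) • (Zr k * Zr l - Zr l * Zr k) = 0)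
    (x y : ℚ) (hx : 0 ≤ x) (hxα : x ≤ α) (hy : 0 ≤ y) (hyβ : y ≤ β) :
    Commute (Z 0 + ∑ ℓ : Fin m, algebraMap ℚ R (sX cf ℓ x y) • Z (ℓ.addNat 2)) (Z 1 + ∑ ℓ : Fin m, algebraMap ℚ R (sY cf ℓ x y) • Z (ℓ.addNat 2)) := by
  have h := (commute_Om_closed cf nZ hcf0 hcf1 φ f g hφ hf hg Zr hZr hα hβ hreg F1 x y hx hxα hy hyβ).map
    (DrinfeldKohnoTrunc.map (ι := Fin 4) (N := N) (algebraMap ℚ R))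
  simp only [OmX, OmY, map_add, map_sum, DrinfeldKohnoTrunc.map_smul, map_Zq_R nZ Z hZ] at h
  exact h

include hcf0 hcf1 hφ hf hg hZr hZ in
/-- **Centrality on the left edge in the target algebra (`F2Q`).** [cite: Furusho2010, §3] -/
theorem F2Q {β : ℚ} (F2 : ∀ y : ℝ, 0 < y → y < (β : ℝ) → ∑ l : Fin (m + 2), g l 0 y • (Zr 0 * Zr l - Zr l * Zr 0) = 0)
    (y : ℚ) (hy : 0 < y) (hyβ : y < β) :
    Commute (Z 0) (Z 1 + ∑ ℓ : Fin m, algebraMap ℚ R (cf (ℓ.addNat 2) 2 * y / (cf (ℓ.addNat 2) 0 + cf (ℓ.addNat 2) 2 * y)) • Z (ℓ.addNat 2)) := by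
  have hyr : (0 : ℝ) < y := by exact_mod_cast hy
  obtain ⟨_, φ1, _, _, g0, g1⟩ := axis_values cf hcf0 hcf1 φ f g hφ hf hg (0 : ℝ) (y : ℝ)
  -- over `ℝ`
  have hreal : Commute (Zr 0) (Zr 1 + ∑ ℓ : Fin m, ((y : ℝ) * g (ℓ.addNat 2) 0 y) • Zr (ℓ.addNat 2)) := by
    have h := F2 y hyr (by exact_mod_cast hyβ)
    have hc : Commute (Zr 0) (∑ l, g l 0 y • Zr l) := by
      rw [Commute, SemiconjBy, ← sub_eq_zero, Finset.mul_sum, Finset.sum_mul, ← Finset.sum_sub_distrib]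
      simpa only [mul_smul_comm, smul_mul_assoc, ← smul_sub] using h
    have hY : (y : ℝ) • ∑ l, g l 0 y • Zr l = Zr 1 + ∑ ℓ : Fin m, ((y : ℝ) * g (ℓ.addNat 2) 0 y) • Zr (ℓ.addNat 2) := by
      rw [Finset.smul_sum, sum_fin_add_two]
      simp only [smul_smul, g0, zero_smul, smul_zero, zero_add, g1]
      rw [mul_one_div_cancel hyr.ne', one_smul]
    rw [← hY]; exact hc.smul_right _
  -- over `ℚ`
  have hinj := DrinfeldKohnoTrunc.map_injective (ι := Fin 4) (N := N) (f := algebraMap ℚ ℝ) (algebraMap ℚ ℝ).injective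
  have hmap : DrinfeldKohnoTrunc.map (algebraMap ℚ ℝ)
      (Zq nZ 1 + ∑ ℓ : Fin m, (cf (ℓ.addNat 2) 2 * y / (cf (ℓ.addNat 2) 0 + cf (ℓ.addNat 2) 2 * y)) • Zq (N := N) nZ (ℓ.addNat 2)) =
      Zr 1 + ∑ ℓ : Fin m, ((y : ℝ) * g (ℓ.addNat 2) 0 y) • Zr (ℓ.addNat 2) := by
    rw [map_add, map_sum, map_Zq_real nZ Zr hZr]
    congr 1
    refine Finset.sum_congr rfl fun ℓ _ => ?_
    rw [DrinfeldKohnoTrunc.map_smul, map_Zq_real nZ Zr hZr, hg, hφ, eq_ratCast]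
    congr 1
    push_cast
    ring
  have hrat : Commute (Zq (N := N) nZ 0) (Zq nZ 1 + ∑ ℓ : Fin m, (cf (ℓ.addNat 2) 2 * y / (cf (ℓ.addNat 2) 0 + cf (ℓ.addNat 2) 2 * y)) • Zq nZ (ℓ.addNat 2)) := by
    apply hinj
    rw [map_mul, map_mul, hmap, map_Zq_real nZ Zr hZr]
    exact hreal.eq
  -- to `R`
  have h := hrat.map (DrinfeldKohnoTrunc.map (ι := Fin 4) (N := N) (algebraMap ℚ R))
  simp only [map_add, map_sum, DrinfeldKohnoTrunc.map_smul, map_Zq_R nZ Z hZ] at h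
  exact h

include hcf0 hcf1 hφ hf hg hZr hZ in
/-- **Centrality on the bottom edge in the target algebra (`F3Q`).** [cite: Furusho2010, §3] -/
theorem F3Q {α : ℚ} (F3 : ∀ x : ℝ, 0 < x → x < (α : ℝ) → ∑ k : Fin (m + 2), f k x 0 • (Zr 1 * Zr k - Zr k * Zr 1) = 0)
    (x : ℚ) (hx : 0 < x) (hxα : x < α) :
    Commute (Z 1) (Z 0 + ∑ ℓ : Fin m, algebraMap ℚ R (cf (ℓ.addNat 2) 1 * x / (cf (ℓ.addNat 2) 0 + cf (ℓ.addNat 2) 1 * x)) • Z (ℓ.addNat 2)) := by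
  have hxr : (0 : ℝ) < x := by exact_mod_cast hx
  obtain ⟨φ0, _, f0, f1, _, _⟩ := axis_values cf hcf0 hcf1 φ f g hφ hf hg (x : ℝ) (0 : ℝ)
  have hreal : Commute (Zr 1) (Zr 0 + ∑ ℓ : Fin m, ((x : ℝ) * f (ℓ.addNat 2) x 0) • Zr (ℓ.addNat 2)) := by
    have h := F3 x hxr (by exact_mod_cast hxα)
    have hc : Commute (Zr 1) (∑ k, f k x 0 • Zr k) := by
      rw [Commute, SemiconjBy, ← sub_eq_zero, Finset.mul_sum, Finset.sum_mul, ← Finset.sum_sub_distrib]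
      simpa only [mul_smul_comm, smul_mul_assoc, ← smul_sub] using h
    have hX : (x : ℝ) • ∑ k, f k x 0 • Zr k = Zr 0 + ∑ ℓ : Fin m, ((x : ℝ) * f (ℓ.addNat 2) x 0) • Zr (ℓ.addNat 2) := by
      rw [Finset.smul_sum, sum_fin_add_two]
      simp only [smul_smul, f1, zero_smul, smul_zero, add_zero, f0]
      rw [mul_one_div_cancel hxr.ne', one_smul]
    rw [← hX]; exact hc.smul_right _
  have hinj := DrinfeldKohnoTrunc.map_injective (ι := Fin 4) (N := N) (f := algebraMap ℚ ℝ) (algebraMap ℚ ℝ).injective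
  have hmap : DrinfeldKohnoTrunc.map (algebraMap ℚ ℝ)
      (Zq nZ 0 + ∑ ℓ : Fin m, (cf (ℓ.addNat 2) 1 * x / (cf (ℓ.addNat 2) 0 + cf (ℓ.addNat 2) 1 * x)) • Zq (N := N) nZ (ℓ.addNat 2)) =
      Zr 0 + ∑ ℓ : Fin m, ((x : ℝ) * f (ℓ.addNat 2) x 0) • Zr (ℓ.addNat 2) := by
    rw [map_add, map_sum, map_Zq_real nZ Zr hZr]
    congr 1
    refine Finset.sum_congr rfl fun ℓ _ => ?_
    rw [DrinfeldKohnoTrunc.map_smul, map_Zq_real nZ Zr hZr, hf, hφ, eq_ratCast]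
    congr 1
    push_cast
    ring
  have hrat : Commute (Zq (N := N) nZ 1) (Zq nZ 0 + ∑ ℓ : Fin m, (cf (ℓ.addNat 2) 1 * x / (cf (ℓ.addNat 2) 0 + cf (ℓ.addNat 2) 1 * x)) • Zq nZ (ℓ.addNat 2)) := by
    apply hinj
    rw [map_mul, map_mul, hmap, map_Zq_real nZ Zr hZr]
    exact hreal.eq
  have h := hrat.map (DrinfeldKohnoTrunc.map (ι := Fin 4) (N := N) (algebraMap ℚ R))
  simp only [map_add, map_sum, DrinfeldKohnoTrunc.map_smul, map_Zq_R nZ Z hZ] at h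
  exact h

include hZr hZ in
/-- The two axis residues commute in the target algebra. [folklore] -/
theorem h01 (h01r : Zr 0 * Zr 1 = Zr 1 * Zr 0) : Commute (Z 0) (Z 1) := by
  have hinj := DrinfeldKohnoTrunc.map_injective (ι := Fin 4) (N := N) (f := algebraMap ℚ ℝ) (algebraMap ℚ ℝ).injective
  have hrat : Commute (Zq (N := N) nZ 0) (Zq nZ 1) := by
    apply hinj; rw [map_mul, map_mul, map_Zq_real nZ Zr hZr, map_Zq_real nZ Zr hZr]; exact h01r
  have h := hrat.map (DrinfeldKohnoTrunc.map (ι := Fin 4) (N := N) (algebraMap ℚ R))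
  rw [map_Zq_R nZ Z hZ, map_Zq_R nZ Z hZ] at h
  exact h

include hZ in
omit [Algebra ℚ R] in
/-- **Truncation**: products of more than `N` residues vanish. [folklore] -/
theorem trunc (w : List (Fin (m + 2))) (hw : N < w.length) : (w.map Z).prod = 0 :=
  DrinfeldKohnoTrunc.prod_map_eq_zero_of_mem_genSpan Z (fun k => by
    rw [hZ]
    exact Submodule.sum_mem _ fun i _ => Submodule.sum_mem _ fun j _ =>
      Submodule.smul_mem _ _ (DrinfeldKohnoTrunc.t_mem_genSpan i j)) w hw

end CornerTransfer

open Shuffle NCSeries in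
/-- **Stub `stub_cornerPrinciple`: THE LOG-FREE CORNER PRINCIPLE** of a flat bilinear corner chart,
for any realisation `χ` of the Kontsevich–Zagier rules: the end-regularised transports of the four
sides of the box `[0,α] × [0,β]` (log-free horizontal transports `H_0, H_β` along `y = 0, β`,
vertical `V_0, V_α` along `x = 0, α`), read at truncated residues, satisfy
`V_α · H_0 = H_β · V_0`.  Proof: the formal cube calculus of `Literature/…/KZCube*` (transverse
flatness TF-Z, the KITE, the corner product identity) applied to the bilinear chart, the bridge
from simplex families to cube series (`simplexToCube`), and the transfer of the real flatness
hypotheses to the target algebra (injective base change `ℚ → ℝ`, polynomial identity principle for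
the closed box). [cite: Furusho2010, §3] -/
theorem stub_cornerPrinciple : ∀ (R : Type) [CommRing R] [Algebra ℚ R] (χ : KZ.FormalRep →+ R), (∀ c ∈ KZ.relations, χ c = 0) → (∀ x y : KZ.FormalRep, χ (x * y) = χ x * χ y) → (∃ u : KZ.FormalRep, χ u = 1) → ∀ (m N : ℕ) (α β : ℚ), 0 < α → 0 < β → ∀ (cf : Fin (m + 2) → Fin 4 → ℚ), cf 0 = ![0, 1, 0, 0] → cf 1 = ![0, 0, 1, 0] → ∀ (φ f g : Fin (m + 2) → ℝ → ℝ → ℝ), (∀ k x y, φ k x y = cf k 0 + cf k 1 * x + cf k 2 * y + cf k 3 * x * y) → (∀ k x y, f k x y = (cf k 1 + cf k 3 * y) / φ k x y) → (∀ k x y, g k x y = (cf k 2 + cf k 3 * x) / φ k x y) → (∀ k : Fin (m + 2), k ≠ 0 → k ≠ 1 → ∀ x y : ℝ, 0 ≤ x → x ≤ (α : ℝ) → 0 ≤ y → y ≤ (β : ℝ) → φ k x y ≠ 0) → ∀ (nZ : Fin (m + 2) → Fin 4 → Fin 4 → ℤ) (Zr : Fin (m + 2) → DrinfeldKohnoTrunc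 ℝ (Fin 4) N), (∀ k, Zr k = ∑ i : Fin 4, ∑ j : Fin 4, (nZ k i j : ℝ) • DrinfeldKohnoTrunc.t ℝ N i j) → Zr 0 * Zr 1 = Zr 1 * Zr 0 → (∀ x y : ℝ, 0 < x → x < (α : ℝ) → 0 < y → y < (β : ℝ) → ∑ k : Fin (m + 2), ∑ l : Fin (m + 2), (f k x y * g l x y) • (Zr k * Zr l - Zr l * Zr k) = 0) → (∀ y : ℝ, 0 < y → y < (β : ℝ) → ∑ l : Fin (m + 2), g l 0 y • (Zr 0 * Zr l - Zr l * Zr 0) = 0) → (∀ x : ℝ, 0 < x → x < (α : ℝ) → ∑ k : Fin (m + 2), f k x 0 • (Zr 1 * Zr k - Zr k * Zr 1) = 0) → ∀ (IHlo IHhi IVlo IVhi : (w : List (Fin (m + 2))) → KZ.IntegralRep w.length), (∀ w : List (Fin (m + 2)), w.getLast? ≠ some 0 → (IHlo w).domain = {t | (∀ i, 0 < t i ∧ t i < (α : ℝ)) ∧ StrictAnti t} ∧ Set.EqOn (IHlo w).integrand (fun t => ∏ i, f (w.get i) (t i) 0) (IHlo w).domain) → (∀ w : List (Fin (m + 2)),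 w.getLast? ≠ some 0 → (IHhi w).domain = {t | (∀ i, 0 < t i ∧ t i < (α : ℝ)) ∧ StrictAnti t} ∧ Set.EqOn (IHhi w).integrand (fun t => ∏ i, f (w.get i) (t i) (β : ℝ)) (IHhi w).domain) → (∀ w : List (Fin (m + 2)), w.getLast? ≠ some 1 → (IVlo w).domain = {t | (∀ i, 0 < t i ∧ t i < (β : ℝ)) ∧ StrictAnti t} ∧ Set.EqOn (IVlo w).integrand (fun t => ∏ i, g (w.get i) 0 (t i)) (IVlo w).domain) → (∀ w : List (Fin (m + 2)), w.getLast? ≠ some 1 → (IVhi w).domain = {t | (∀ i, 0 < t i ∧ t i < (β : ℝ)) ∧ StrictAnti t} ∧ Set.EqOn (IVhi w).integrand (fun t => ∏ i, g (w.get i) (α : ℝ) (t i)) (IVhi w).domain) → ∀ (PHlo PHhi PVlo PVhi : NCSeries (Fin (m + 2)) R), (∀ W, PHlo W = if W = [] then 1 else Shuffle.pair (fun w => χ (KZ.of (IHlo w))) (Shuffle.regEnd 0 W)) → (∀ W, PHhi W = if W = [] then 1 else Shuffle.pair (fun w => χ (KZ.of (IHhi w))) (Shuffle.regEnd 0 W))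 → (∀ W, PVlo W = if W = [] then 1 else Shuffle.pair (fun w => χ (KZ.of (IVlo w))) (Shuffle.regEnd 1 W)) → (∀ W, PVhi W = if W = [] then 1 else Shuffle.pair (fun w => χ (KZ.of (IVhi w))) (Shuffle.regEnd 1 W)) → ∀ (Z : Fin (m + 2) → DrinfeldKohnoTrunc R (Fin 4) N), (∀ k, Z k = ∑ i : Fin 4, ∑ j : Fin 4, (nZ k i j : R) • DrinfeldKohnoTrunc.t R N i j) → NCSeries.evalTrunc N Z PVhi * NCSeries.evalTrunc N Z PHlo = NCSeries.evalTrunc N Z PHhi * NCSeries.evalTrunc N Z PVlo := by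
  intro R _ _ χ hrel hmul _ m N α β hα hβ cf hcf0 hcf1 φ f g hφ hf hg hreg nZ Zr hZr h01r F1 F2 F3 IHlo IHhi IVlo IVhi hIHlo hIHhi hIVlo hIVhi
    PHlo PHhi PVlo PVhi hPHlo hPHhi hPVlo hPVhi Z hZ
  -- the bilinear corner chart
  have hk : ∀ ℓ : Fin m, (ℓ.addNat 2 : Fin (m + 2)) ≠ 0 ∧ (ℓ.addNat 2 : Fin (m + 2)) ≠ 1 := fun ℓ =>
    ⟨fun h => by have := congrArg Fin.val h; simp only [Fin.val_addNat, Fin.val_zero] at this; omega,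
     fun h => by have := congrArg Fin.val h; simp only [Fin.val_addNat, Fin.val_one] at this; omega⟩
  let Γ : CornerChart m :=
    { cA := fun ℓ => cf (ℓ.addNat 2) 0, cB := fun ℓ => cf (ℓ.addNat 2) 1, cC := fun ℓ => cf (ℓ.addNat 2) 2, cD := fun ℓ => cf (ℓ.addNat 2) 3,
      α := α, β := β, hα := hα, hβ := hβ,
      hreg := fun ℓ x y hx hxα hy hyβ => by
        have h := hreg (ℓ.addNat 2) (hk ℓ).1 (hk ℓ).2 x y hx hxα hy hyβ
        rwa [hφ] at h }
  have hregQ : ∀ (ℓ : Fin m) (x y : ℚ), 0 ≤ x → x ≤ α → 0 ≤ y → y ≤ β → CornerTransfer.φq cf ℓ x y ≠ 0 := by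
    intro ℓ x y hx hxα hy hyβ hzero
    refine Γ.hreg ℓ (x : ℝ) (y : ℝ) (by exact_mod_cast hx) (by exact_mod_cast hxα) (by exact_mod_cast hy) (by exact_mod_cast hyβ) ?_
    have h := congrArg (fun q : ℚ => (q : ℝ)) hzero
    simp only [CornerTransfer.φq, Rat.cast_zero, Rat.cast_add, Rat.cast_mul] at h
    exact h
  have hax := fun x y => CornerTransfer.axis_values cf hcf0 hcf1 φ f g hφ hf hg x y
  letI : Module ℚ (DrinfeldKohnoTrunc R (Fin 4) N) := Module.compHom _ (algebraMap ℚ R)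
  haveI : IsScalarTower ℚ R (DrinfeldKohnoTrunc R (Fin 4) N) :=
    ⟨fun q r x => show ((q • r) • x : DrinfeldKohnoTrunc R (Fin 4) N) = algebraMap ℚ R q • (r • x) by
      rw [Algebra.smul_def q r, mul_smul]⟩
  refine corner_principle Γ hrel hmul Z (CornerTransfer.trunc nZ Z hZ) (CornerTransfer.h01 nZ Zr hZr Z hZ h01r)
    (fun x y hx hxα hy hyβ => CornerTransfer.F1Q cf nZ hcf0 hcf1 φ f g hφ hf hg Zr hZr Z hZ hα hβ hregQ F1 x y hx hxα hy hyβ)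
    (fun y hy hyβ => CornerTransfer.F2Q cf nZ hcf0 hcf1 φ f g hφ hf hg Zr hZr Z hZ F2 y hy hyβ)
    (fun x hx hxα => CornerTransfer.F3Q cf nZ hcf0 hcf1 φ f g hφ hf hg Zr hZr Z hZ F3 x hx hxα)
    (fun k s => f k s 0) (fun k s => f k s β) (fun k s => g k 0 s) (fun k s => g k α s)
    (fun s _ _ => (hax s 0).2.2.1) (fun s _ _ => (hax s 0).2.2.2.1)
    (fun ℓ s _ _ => by show f (ℓ.addNat 2) s 0 = _; rw [hf, hφ]; ring)
    (fun s _ _ => (hax s β).2.2.1) (fun s _ _ => (hax s β).2.2.2.1)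
    (fun ℓ s _ _ => by show f (ℓ.addNat 2) s β = _; rw [hf, hφ]; push_cast; ring)
    (fun s _ _ => (hax 0 s).2.2.2.2.2) (fun s _ _ => (hax 0 s).2.2.2.2.1)
    (fun ℓ s _ _ => by show g (ℓ.addNat 2) 0 s = _; rw [hg, hφ]; ring)
    (fun s _ _ => (hax α s).2.2.2.2.2) (fun s _ _ => (hax α s).2.2.2.2.1)
    (fun ℓ s _ _ => by show g (ℓ.addNat 2) α s = _; rw [hg, hφ]; push_cast; ring)
    IHlo IHhi IVlo IVhi hIHlo hIHhi hIVlo hIVhi PHlo PHhi PVlo PVhi hPHlo hPHhi hPVlo hPVhi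

end Summit.KontsevichZagierPeriods.FurushoPentagon.PentagonInKZ
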